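import Mathlib
import HarnessLib
import HarnessLib.Audit
import Summits.AtomisticToContinuum.Statement
import Literature.Barriers.AtomisticToContinuum.NoUniversallyOptimalLattice3D
import Literature.MathematicalPhysics.StatisticalMechanics.BarlowStacking
import Literature.MathematicalPhysics.StatisticalMechanics.BarlowStackingEnergy
import Summits.AtomisticToContinuum.Crystallization.Theorems.ExcessDecayLiouvilleCrysEnergyLimit
import HarnessLib.Audit.Status.Attr

/-!
Route: HcpThetaUniversality

# Route HcpThetaUniversality — hcp is theta-universally optimal among PACKINGS; LJ ground states are
near-optimal vdW packers by the virial identity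

It suffices to show X = X₁ ∧ X₂ ∧ X₃ ∧ X₄ (card theta-universality-packings). X₁ (Θ-PACK, pure
discrete geometry): for EVERY
Gaussian parameter t > 0 and every finite unit packing x of ℝ³ (pairwise distances ≥ 1), Σ_{i≠j}
e^{−t|x_i−x_j|²} ≤ N·θ_hcp(t),
θ_hcp(t) = Σ_{y∈hcp∖0} e^{−t|y|²} at nearest-neighbour distance 1 — by Bernstein, hcp maximises the
per-particle sum of every
completely monotone function of the squared distance among packings (the packing-constrained,
maximising form of Cohn–Kumar
universal optimality; its two endpoint limits t→0 / t→∞ are Kepler and the twelve-sphere theorem at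
leading order). X₂ (LJ
TRANSFER): by the virial identity E = −(1/24)Σ_{i≠j} r⁻⁶ Lennard-Jones ground states, cleaned of ≤
N/1000 particles and rescaled
by λ ∈ [1, 53/50], are unit packings within 1/20 per particle of hcp's r⁻⁶ value L₆ = 14.4549. X₃
(RIGIDITY ENDGAME): ground
states that are 1/20-near-maximisers of the r⁻⁶ packing problem (against every finite packing)
crystallize positionally
(IsCrystallizing). X₄ = the periodic LJ minimum is attained (shared 0627). X₁ makes X₂'s hcp
benchmark THE packing supremum, so
X₂ ⇒ hypothesis of X₃; with 0627 and the bookkeeping limit 0626 this is Crystallization.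
Lean: `HcpThetaMaxPackings ∧ LjGroundStatesNearInvSixMax ∧ NearMaxGroundStatesCrystallize ∧
CrysPeriodicMinAttained`

## Assembly
The deciding theorem `closes` (D-0027 §2.1; rev 4, sorry-free, axioms ⊆ {propext, Classical.choice,
Quot.sound}) does the
bookkeeping itself, directly from the items: ThetaMaxImpliesSutherlandBound applied to
HcpThetaMaxPackings gives SutherlandBound,
i.e. S₆(y) ≤ M·L₆(hcp) for every finite unit packing y of M points, hence S₆(y)/M − 1/20 ≤ L₆(hcp) −
1/20 (M = 0 by L₆ ≥ 0,
`div_le_of_le_mul₀`), so the conclusion of LjGroundStatesNearInvSixMax (benchmark L₆(hcp) − 1/20)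
implies the hypothesis of
NearMaxGroundStatesCrystallize (benchmark S₆(y)/M − 1/20 for all y), giving IsCrystallizing;
CrysPeriodicMinAttained gives P with
IsLeast, so ⨅_Q e(Q) = e(P) (IsLeast.csInf_eq) and CrysEnergyLimit is the limit clause of
HasPeriodicGroundStateEnergy. The item
`Assembly` is restated (rev 4) as exactly this chain WITH the Bernstein antecedent,
HcpThetaMaxPackings →
ThetaMaxImpliesSutherlandBound → LjGroundStatesNearInvSixMax → NearMaxGroundStatesCrystallize →
CrysPeriodicMinAttained →
CrysEnergyLimit → Crystallization, so it is provable now by the same few lines (the rev-0 Assembly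
omitted the antecedent and hid
item 5059's real analysis inside a bookkeeping item). Load-bearing: HcpThetaMaxPackings,
ThetaMaxImpliesSutherlandBound,
LjGroundStatesNearInvSixMax, NearMaxGroundStatesCrystallize, CrysPeriodicMinAttained,
CrysEnergyLimit; Target, SutherlandBound,
BarlowThetaDominance, LjVirialInvSix and Assembly are hypotheses of `closes` it does not use (the
thesis statement X, the
standalone r⁻⁶ theorem, the foreseen tools of cruxes 2 and 4, the legacy assembly). Import cone: no
unproved named fact — the
items use only definitions (gaussianEnergy, hcpStacking, barlowSiteEnergy, IsHaggSeq,
alternatingHagg, IsGroundState,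
interactionEnergy, groundStateEnergy, PeriodicConfiguration, IsCrystallizing, lennardJones) and the
target abbrev Crystallization;
route imports are the three files defining them (NoUniversallyOptimalLattice3D, BarlowStacking,
BarlowStackingEnergy).

Rationale: WHY THIS LINE. Density-constrained universal optimality FAILS in d = 3 (CohnKumar2006 §9, in tree as
Literature.Barriers.AtomisticToContinuum.NoUniversallyOptimalLattice3D:
fcc loses to bcc for e^{−x} at unit density) because a competitor may trade minimal distance for
intermediate shells; the PACKING
constraint removes exactly that trade, pins the large-t end to the kissing problem where d = 3 is
rigid (Hales2012) and the small-t
end to Kepler (HalesEtAl2015), and theta selects hcp over fcc and every Barlow stacking at every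
finite t (BeterminPetrache2017
Example 2.6 + monotone pairing of the aligned-minus-staggered layer sums), so the variational
problem has ONE answer. For
Lennard-Jones the virial identity at any dilation-critical configuration kills the repulsion exactly
(E = −S₆/24), turning
"hcp minimises LJ" into the one-signed extremal problem "hcp maximises Σ r⁻⁶ among packings" at the
ground state's own scale, up
to a relaxation/compression loss that is budgeted explicitly (1/20 per particle; own lattice sums:
the relaxed-hcp floor is 2e-3).
Imported: universal optimality / theta functions of periodic sets (CohnKumar2006, CohnEtAl2019,
CoulangeonSchurmann2011,
BeterminPetrache2017), densest-local-packing data (HopkinsStillingerTorquato2011), the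
virial/scaling identity of cluster physics
(BlancLewin2015 §1). Versus existing routes: MieLadderVdwKissing poses the r⁻⁶ slice POINTWISE
(VdwOneCentre, which DLP data
threaten) and reaches LJ by descent in the Mie exponent;
CrystalKissingRigidity/SteepnessLadderOneCentre count contacts; this line
is AVERAGED (immune to one-centre DLP counterexamples), covers all CM tails at once, and reaches
LJ(12,6) directly through the
virial identity; the negatives index is empty.

RANKED CRUXES. #0 Target (target) — X = Θ-universality of hcp among packings ∧ LJ ground states are
1/20-near-maximal vdW packers after cleaning/rescaling ∧ near-maximal-packer ground states
crystallize positionally ∧ the periodic LJ minimum is attained. (why it might fail: Conjunction of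
three open statements and 0627; dies most cheaply with ONE packing beating θ_hcp(t) at ONE t (the
card's kit grid), or with LJ ground states keeping a density > 1e-3 of compressed cores.)
[CohnKumar2006, HopkinsStillingerTorquato2011, BlancLewin2015, Stillinger2001]
#2 HcpThetaMaxPackings (crux) — Θ-PACK (card (Θ-pack), finite averaged form, equivalent to the
stationary form by superadditivity): for every t > 0, every N and every x : Fin N → ℝ³ with pairwise
distances ≥ 1, Σ_i Σ_{j≠i} exp(−t·dist(x_i,x_j)²) ≤ N · gaussianEnergy t (hcpStacking 1 √(2/3)) (=
N·θ_hcp(t), hcp at nearest-neighbour distance 1, rooted at its point 0). [difficulty: open-problem]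
(why it might fail: Only hand checks exist (bcc, sc, ico, A15 lose); a non-Barlow packing trading a
few contacts for many neighbours in (1,√2) could win at t≈1–5: DLP gives Z_max(R) > Z_Bar(R) for all
N ≥ 13, so the POINTWISE form is false; even t→∞ is protected by Hales2012 only at leading order.)
[CohnKumar2006, CohnEtAl2019, HopkinsStillingerTorquato2011, BeterminPetrache2017, Hales2012,
HalesEtAl2015, CoulangeonSchurmann2011, ConwaySloane1999]
#3 NearMaxGroundStatesCrystallize (crux) — RIGIDITY ENDGAME (card N5 "stability form" + the
perturbative endgame, positional half): if for every sequence of Lennard-Jones ground states x^N,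
eventually in N, there are S ⊆ Fin N with #(Fin N∖S) ≤ N/1000 and λ ∈ [1, 53/50] such that λ·x^N|S
is a unit packing whose r⁻⁶ double sum is ≥ #S·(S₆(y)/M − 1/20) for EVERY finite unit packing y of M
points (i.e. within 1/20 per particle of the packing supremum), then IsCrystallizing lennardJones 3
(Blanc–Lewin (15)–(17)). [deps: HcpThetaMaxPackings] [difficulty: open-problem] (why it might fail:
A 1/20 deficit is stacking-blind (fcc: 1e-3) and tolerates ≈0.3% vacancies or DLP-type 13-neighbour
sites; exact order must come from LJ minimality + stacking selection (J₂≈−7e-5, uncertified): no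
self-improvement mechanism in print; aperiodic/polytypic Barlow ground states refute it.)
[BlancLewin2015, Hales2012, BoroczkySzabo2016, KusnerKusnerLagariasShlosman2018,
PartayOrtnerCsanyi2017, Stillinger2001, FlatleyTheil2015]
#4 LjGroundStatesNearInvSixMax (crux) — LJ TRANSFER (card N5 "no-compression" + virial, made
quantitative): for every sequence of LJ ground states, eventually in N there are S ⊆ Fin N, #(Fin
N∖S) ≤ N/1000, and λ ∈ [1, 53/50] with λ·dist ≥ 1 on S and Σ_{i,j∈S} (λ·dist(x_i,x_j))⁻⁶ ≥
#S·(L₆(hcp) − 1/20), L₆(hcp) = Σ_{y∈hcp} |y|⁻⁶ = 14.4549 at nearest-neighbour distance 1. Expected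
proof: virial E = −S₆/24 (LjVirialInvSix) + trial upper bound E(N) ≤ N·e(hcp) + C N^{2/3} (e(hcp) =
−L₆²/(24 L₁₂), scale a* = (L₁₂/L₆)^{1/6} = 0.9712) + LennardJonesMinimalDistance_holds + a
NO-COMPRESSION lemma (bonds shorter than (1−η)a*, η ≈ 5e-4, at o(N) particles) + sum_inv_pow_six_le
for the discarded particles. [difficulty: XL] (why it might fail: Needs NO-COMPRESSION: bonds
shorter than 0.9995·a* (a* = 0.9712) on ≤ N/1000 particles eventually; persistent icosahedral cores
(LJ₁₃ radial bonds ≈3% short) or strained grain boundaries at density > 1e-3 break it; the budget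
6η·L₆ ≤ 0.048 leaves no slack for η > 6e-4.) [BlancLewin2015, Xue1997, Blanc2004, Stillinger2001,
Doye2000, arXiv:1009.3003]
#5 CrysPeriodicMinAttained (crux) — the infimum over periodic configurations of ℝ³ (full-rank
lattice + finite motif) of the Lennard-Jones energy per particle is attained (shared item 0627 of
CrystalKissingRigidity / CrystalLocalRigidity / RefuteCrystalPeriodicMin; expected minimiser:
relaxed hcp, cf. PoissonBesselStacking.HcpPeriodicMinimiser). [difficulty: L] (why it might fail:
False iff no periodic configuration attains inf e_LJ: stackings of growing period tending to an
aperiodic Barlow optimum (route RefuteCrystalPeriodicMin), i.e. Hägg domination |J₂| > Σ k|J_k|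
fails (1e-4 margin); print covers Bravais lattices only.) [BlancLewin2015,
BeterminSamajTravenec2022, PartayOrtnerCsanyi2017, Stillinger2001]
#9 SutherlandBound (support) — the r⁻⁶ (van der Waals, s⁻³) slice of Θ-PACK — "hcp maximises the vdW
attraction among all sphere packings": for every N-point unit packing x of ℝ³, Σ_i Σ_j
dist(x_i,x_j)⁻⁶ ≤ N·L₆(hcp) (diagonal and y = 0 terms are 0⁻¹ = 0 in Lean). SHARED verbatim with
MieLadderVdwKissing.SutherlandBound (stmt-3268); here it is the corollary of HcpThetaMaxPackings via
ThetaMaxImpliesSutherlandBound and the benchmark of cruxes 3–4. [difficulty: L] [Stillinger2001,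
ConwaySloane1999, HopkinsStillingerTorquato2011]
#9 ThetaMaxImpliesSutherlandBound (support) — GLUE (Bernstein): r⁻⁶ = ½∫₀^∞ t² e^{−t r²} dt, finite
sums commute with the integral and Tonelli evaluates ∫ ½t²·θ_hcp(t) dt = L₆(hcp) (summable,
non-negative terms); hence HcpThetaMaxPackings → SutherlandBound. This is the step that makes crux 2
load-bearing in the Assembly. [difficulty: provable-now] [CohnKumar2006, CoulangeonSchurmann2011]
#9 BarlowThetaDominance (support) — BARLOW-INTERNAL THEOREM (card evidence (a); realises card
monotone-pairing-stacking-lemma for Gaussians): for every t > 0, every Hägg sequence s and every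
layer m, the Gaussian site energy of barlowStacking 1 √(2/3) s at layer m is ≤ that of hcp
(alternatingHagg) at layer 0. Proof sketch: J_k(t) = e^{−t k² (2/3)}·(φ_A − φ_N)(t) with φ_A > φ_N
by Poisson summation on the triangular layer (1 − cos ≥ 0), so J_k > 0 decreasing in k; the aligned
set of any site has no two consecutive k and misses k = 1, so Σ_{k aligned} J_k ≤ Σ_{k even} J_k
(monotone pairing) — the hcp site. [difficulty: M] [BeterminPetrache2017, ConwaySloane1999,
HalesDSP2012]
#9 LjVirialInvSix (support) — VIRIAL IDENTITY: a Lennard-Jones ground state x of N particles in ℝ³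
is critical under dilation x ↦ λx, so Σ r⁻¹² = Σ r⁻⁶ over pairs and interactionEnergy lennardJones x
= −(1/24) Σ_i Σ_j dist(x_i,x_j)⁻⁶ (diagonal 0⁻¹ = 0); N ≤ 1 trivial. [difficulty: provable-now]
[BlancLewin2015, Doye2000]
#9 CrysEnergyLimit (support) — E(N)/N → ⨅ over periodic configurations of the LJ energy per particle
(shared item 0626; thermodynamic-limit bookkeeping: periodisation gives ⨅ ≤ E(N)/N for every N,
trial blocks give limsup ≤ ⨅). [difficulty: M] [BlancLewin2015]

TWO-LAYER PLAN. Foreseen glued splits (k ≤ 3, depth 1; nothing filed now).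
NearMaxGroundStatesCrystallize ⇐ PackingStabilityTwelve (pure geometry:
a unit packing within δ per particle of the r⁻⁶ supremum has all but ε(δ)N sites with exactly 12
neighbours within 26/25; the
stability modulus is the unknown the DLP data bear on) → LjSelfImprovement (exact LJ ground states
that are mostly 12-coordinated
within 26/25 have vanishing defect density w.r.t. ONE periodic P: BulkDefectVanish, shared 0751,
through RobustFejesTothHales 0758
+ Hägg domination 0716/0737) → DefectVanishCrystallizes (shared 0752, with
LennardJonesMinimalDistance_holds).
LjGroundStatesNearInvSixMax ⇐ LjNoCompression (fraction of particles with a bond < (1 − 6e-4)·a*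
tends to 0) → TrialUpperBound
(E(N) ≤ N·e(hcp, a*) + C N^{2/3}; cf. CrystalEnergyDerivative.TrialUpperBound) → glue
(LjVirialInvSix + sum_inv_pow_six_le).
HcpThetaMaxPackings ⇐ small-t regime (t ≤ t₀: quantitative Kepler stability) → large-t regime (t ≥
t₁: near-kissing configurations,
robust Fejes Tóth–Hales with rate) → window [t₀, t₁] (certified cell inequalities; one-parameter
Gaussian scores are monotone in every
distance, so every cell inequality is "fewer/farther points lose").

KILL CRITERIA. A packing x and a parameter t with Σ_{i≠j}e^{−t d²} > N·θ_hcp(t) refutes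
HcpThetaMaxPackings: if the r⁻⁶ slice survives, repair by
`--restate HcpThetaMaxPackings` to the CM sub-cone it still spans (at worst SutherlandBound itself,
a genuine weakening, not a rewording);
if SutherlandBound dies too (a periodic non-Barlow unit packing with r⁻⁶ energy per particle >
14.4549) the line is dead — close
`refuted:HcpThetaMaxPackings` (news for every dispersion-tail card; MieLadderVdwKissing dies with
it). LjGroundStatesNearInvSixMax
refuted (compressed cores at density > 1e-3 in large LJ ground states, numerically first:
Northby/Doye databases extrapolated, then a
proof) ⇒ the virial transfer is too lossy: close `superseded --by
route-AtomisticToContinuum-PRDenominatorTransfer` (scale-free quotient).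
NearMaxGroundStatesCrystallize can only die with IsCrystallizing itself (aperiodic / polytypic LJ
ground states) — conjunct-level news,
close refuted. 0627 refuted ⇒ the conjunct is false as formalised (all routes). HcpThetaMaxPackings
PROVED elsewhere or SutherlandBound
proved via MieLadderVdwKissing.VdwOneCentre moots crux 2's role in the assembly (keep it as the
thesis' standalone theorem).

NOT DECOMPOSED YET. The stability modulus of the r⁻⁶ packing problem and the LJ self-improvement
step (children of crux 3); the no-compression lemma and
the trial upper bound with its N^{2/3} constant (children of crux 4); the regime split of crux 2 in
t and any certified cell
inequalities; uniqueness of the maximiser up to rigid motion and the stationary-point-process form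
of Θ-PACK (not needed for the
assembly); the d = 8 / 24 rung of the card (reversed-inequality magic functions — belongs to
ZeroPressureMagicLadder's territory and is
not load-bearing here); endpoint lemmas t → 0 / t → ∞ (only leading-order corollaries of
HalesEtAl2015 / Hales2012, see crux 2's
why-might-fail). All wait for crux 2 to survive the falsification grid.

CHEAPEST FALSIFIER. The card's one-afternoon kit grid: Θ_X(t) = (1/N)Σ_{i≠j}e^{−t d²} on t ∈
{0.05,…,20} for X ∈ {fcc, dhcp, 9R, bcc, sc, A15, σ, C14/C15,
β-Mn, tetrahelix/Boerdijk–Coxeter rod packings, Conway–Jiao–Torquato tet-oct tilings, DLP clusters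
of arXiv:1009.3003 embedded in hcp,
50 LJ/sticky inherent structures}, all rescaled to minimal distance 1, against θ_hcp(t): ONE
exceedance kills crux 2. What I ran
(folder scratch/theta_check*.py, plain python, hard cutoff R = 7–15): hcp − bcc = 20.1, 3.90, 1.38,
0.641, 0.223, 0.103, 0.020, 0.0012
and hcp − sc = 71.6, 14.0, 4.96, 2.30, 0.744, 0.286, 0.040, 0.002 at t = 0.1, 0.3, 0.6, 1, 2, 3, 5,
8 (all positive); hcp − fcc =
+8.4e-6, 2.2e-4, 9.1e-5, 1.5e-6, 8.6e-10 at t = 1, 2, 3, 5, 8 (positive; below t ≈ 0.5 the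
difference is under cutoff/double
precision, its true size being ~e^{−13.2/t} by Poisson duality). No FK phase or DLP cluster was run
here — that is the refuter's first job.

NUMBERS. Own lattice sums (scratch/hcp_relax*.py; cutoff 9–11 + continuum tail): L₆(hcp) =
14.454911, L₁₂(hcp) = 12.132294, L₆(fcc) = 14.453950,
L₁₂(fcc) = 12.131880 at nearest-neighbour distance 1 (Stillinger2001; MieLadderVdwKissing NUMBERS
agree: 14.45489 / 12.13229);
a* = (L₁₂/L₆)^{1/6} = 0.971228; e(hcp, ideal) = −L₆²/(24 L₁₂) = −0.7175905, e(fcc) = −0.7175195. LJ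
relaxation of hcp: c/a − ideal =
−(2.5…6.8)e-5 relative (cutoff-sensitive), energy gain 1.0e-6, nearest-neighbour deviations
±2.3e-5·a*, r⁻⁶ deficit of the relaxed
shape at unit minimal distance 2.0e-3 (fcc: 9.6e-4) — the floor under which no deficit budget can
go. Budget of crux 4: deficit ≤
6η·L₆ + 2B·κ + 2e-3 + o(1) with compression tolerance η and discarded fraction κ ≤ 1/1000: 1/20 ⇔ η
≤ 5.5e-4 (24× the relaxation
scale). Window arithmetic for the foreseen split of crux 3: λ ≤ 53/50 needs min distance on S ≥
0.943 (bulk 0.9712); in LJ units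
"12 within 26/25, none in (26/25, 5/4)" maps inside "12 within 26/25·λ⁻¹, none in (26/25, 1.33)" ⊂
(1, √2) in packing units; a
discarded particle lies within 5/4 of ≤ 48 sites of S. DLP (arXiv:1009.3003): R_min(13) = 1.045573
(Tammes-13, MusinTarasov2012),
Z_max(R) > Z_Bar(R) for all N ≥ 13 (p. 6); widened square hollow of side 1.05 admits a 13th centre
at 1.340; hcp shells (d², count):
(1,12), (2,6), (8/3,2), (3,18), (11/3,12), (4,6); fcc: (1,12), (2,6), (3,24), (4,12). Items at open:
11 (target, 4 cruxes, 5 support, assembly).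

DEFINITION REQUESTS. None at open: gaussianEnergy (NoUniversallyOptimalLattice3D.lean), hcpStacking
/ barlowStacking / barlowSiteEnergy / alternatingHagg /
IsHaggSeq (BarlowStacking.lean, BarlowStackingEnergy.lean, HaggStacking.lean), IsGroundState /
interactionEnergy / lennardJones /
PeriodicConfiguration / IsCrystallizing (Crystallization.lean) exist; LennardJonesMinimalDistance
and LennardJonesGroundStatesExist are
PROVED facts (LennardJonesClusters.lean), so the import cone carries no unproved named fact.
Foreseen (layer 2): a stationary hard-core
point-process / rooted-theta notion only if the uniqueness / point-process form of Θ-PACK is ever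
wanted (shared with cards
palm-unimodular-zero-pressure-limit, benjamini-schramm-ground-states); bib entry
HopkinsStillingerTorquato2011 added this session.

Novelty: Searches (2026-08-15): `lit frontier AtomisticToContinuum --since 2020` (30 rows; crystallization
descendants arXiv:2407.20762,
arXiv:2604.19239 — planar / polycrystal, nothing on packing-constrained energies); `lit bridges
AtomisticToContinuum --cross any` (30
rows, none on packings/theta); `lit search --source zbmath "universally optimal periodic
configuration"` (2: arXiv:2307.15822
Hardin–Tenpas, density-constrained d = 2; Borodachov–Hardin–Saff monograph); `lit search --source
crossref "densest local packing
spheres Barlow Hopkins Stillinger Torquato"` (6: doi:10.1103/physreve.83.011304,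
doi:10.1103/physreve.81.041305, doi:10.1063/1.3372627);
`lit search --source crossref "universally optimal packing completely monotone hard sphere maximum
energy"` (9, noise); `lit vsearch
"among all packings of unit balls … hcp maximizes the sum of a completely monotone function …"` (8
book hits: Hales DSP pp 18–23,
Conway–Sloane pp 14/253, Finch pp 520–521 — packing density / kissing / LJ lattice constants, no
packing-constrained universality);
`lit search --hybrid "theta function hcp fcc Barlow stacking comparison completely monotone"` (8,
noise); `lit galaxy search
"universally optimal" --star all` (32 rows, noise); `lit read arXiv:1009.3003 --grep
Barlow|R_min|Z_max` (201 lines; p.3 R_min(13),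
p.6 Z_max > Z_Bar); `lit read arXiv:1705.01751` (polytypes; no c/a numbers); the card's two refuter
novelty audits (crossref/zbMATH
"universally optimal packing", "sum of moments packing three  [refs: 10.1103/physreve.83.011304, 10.1103/physreve.81.041305, 10.1063/1.3372627, 2407.20762, 2604.19239, 2307.15822, 1009.3003, 1705.01751, doi:10.1103/physreve.83.011304, doi:10.1103/physreve.81.041305, doi:10.1063/1.3372627, CohnKumar2006, CohnEtAl2019, SarnakStrombergsson2006, BeterminPetrache2017, HopkinsStillingerTorquato2011]

Barriers (technique_class: packing-universality theta-interpolation virial-reduction): - technique_class: packing-universality theta-interpolation virial-reduction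
- Literature.Barriers.AtomisticToContinuum.NoUniversallyOptimalLattice3D: APPLIES to the
density-constrained problem only (fcc vs bcc for e^{−x} at covolume 1, proved in tree); evaded by
the constraint change — at equal MINIMAL DISTANCE bcc has 8 contacts and loses at every t computed
(hcp − bcc = 0.64 at t = 1, 0.10 at t = 3), and the competitor class is all packings, periodic or
not, with hcp (not a Bravais lattice) as the conjectured optimiser.
- Literature.Barriers.AtomisticToContinuum.Li2022_cohnElkies3D: APPLIES to any two-point LP
certificate for crux 2 (at small t it reduces to Cohn–Elkies, gapped in d = 3; at large t to the
Delsarte kissing gap 13 vs 12); evaded by not proposing an LP in d = 3 at all — crux 2 is to be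
proved geometrically (regime split of the Two-layer plan), the LP being reserved for the d = 8/24
rung, which this route does not file.
- Literature.Barriers.AtomisticToContinuum.KissingTwelveDegeneracy: APPLIES to contact counting
(twelve contacts never select the walk); evaded because the functional is the full theta / r⁻⁶ sum
over ALL shells, which selects hcp over every Hägg word sitewise at every t (BarlowThetaDominance,
its evasion (ii)); conceded that crux 3's 1/20 budget is itself stacking-blind, so selection
re-enters inside crux 3 (Hägg domination 0716/0737).
- Literature.Barriers.AtomisticToContinuum.ShortRangeStackingBlindness: respected — nothing of range
< √(8/3)

History (route lifecycle, newest last):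
- 2026-08-15T11:41:34Z · rev 1: restated Target (stmt-AtomisticToContinuum-5055) — frame fix: Target (rank 0) is written before the crux decls it named, so inline the four conjuncts (same statement, no forward references) (planner-plancard-AtomisticToContinuum-Crystal-59533162-0)
- 2026-08-15T16:34:39Z · rev 4: restated Assembly (stmt-AtomisticToContinuum-5062) — route-repair (cone, gen 2): needs-fact: none. The route-level cone (#h21_route_deps run on the rendered file: 36 project consts) contains NO unproved 0-binder f (planner-rrepair-AtomisticToContinuum-HcpThetaU-78b51b31-g2-0)
- 2026-08-16T03:46:19Z · AUTO-CRUX (backfill): Target — hypotheses of the deciding theorem that nothing in the route derives are cruxes (operator:999:586464)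
- 2026-08-24T05:16:06Z · DORMANT — reconciler: no traction for 6.6 d (last activity statement-attached at 2026-08-17T15:13:09Z); parked, not closed — `ledger route dormant route-AtomisticToContin (operator:999:3236649)
- 2026-08-31T09:28:18Z · REACTIVATED (open) — reconciler: reactivated — activity statement-checked at 2026-08-31T08:36:26Z after parking at 2026-08-24T05:16:06Z (operator:999:2636202)

sub-problem: Crystallization · status: open · opened planner-plancard-AtomisticToContinuum-Crystal-59533162-0 2026-08-15T11:39:31Z · rev 5 · ledger route-AtomisticToContinuum-HcpThetaUniversality
GENERATED by the gate from the ledger (D-0016/17). Provers cite these decls: `theorem foo : Summit.AtomisticToContinuum.Crystallization.Theses.HcpThetaUniversality.<Decl> := …` in Summits/AtomisticToContinuum/Crystallization/Theorems/<Name>.lean.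
-/

namespace Summit.AtomisticToContinuum.Crystallization.Theses.HcpThetaUniversality

open scoped BigOperators Topology Manifold Classical MeasureTheory ProbabilityTheory Matrix InnerProductSpace ComplexConjugate ContinuousMap
open Filter Set Function TopologicalSpace MeasureTheory

attribute [summit_statement] _root_.Crystallization

-- earlier Target (stmt-AtomisticToContinuum-5055, replaced 2026-08-15T11:41:34Z -> stmt-AtomisticToContinuum-5558): retired by None — HcpThetaMaxPackings ∧ LjGroundStatesNearInvSixMax ∧ NearMaxGroundStatesCrystallize ∧ CrysPeriodicMinAttained
/-- item stmt-AtomisticToContinuum-5558 · crux (kind.auto-crux: conjecture-grade) · rank 0 · open · by planner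
why it might fail: Conjunction of three open statements and 0627; dies most cheaply with ONE finite unit packing beating N·θ_hcp(t) at ONE t (FK, DLP and rod packings were never run on the grid), or with large LJ ground states keeping a density > 1e-3 of particles with a bond compressed by > 6e-4·a*.
sources: CohnKumar2006, HopkinsStillingerTorquato2011, BlancLewin2015, Stillinger2001
[target] X = Θ-universality of hcp among packings ∧ LJ ground states are 1/20-near-maximal vdW
packers after cleaning/rescaling ∧ near-maximal-packer ground states crystallize positionally ∧ the
periodic LJ minimum is attained. -/
@[route_item "route-AtomisticToContinuum-HcpThetaUniversality", crux]
def Target : Prop :=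
  (∀ t : ℝ, 0 < t → ∀ (N : ℕ) (x : Fin N → EuclideanSpace ℝ (Fin 3)), (∀ i j, i ≠ j → 1 ≤ dist (x i) (x j)) → ∑ i, ∑ j ∈ Finset.univ.erase i, Real.exp (-t * dist (x i) (x j) ^ 2) ≤ (N : ℝ) * Literature.Barriers.AtomisticToContinuum.gaussianEnergy t (Literature.MathematicalPhysics.StatisticalMechanics.hcpStacking 1 (Real.sqrt (2 / 3)))) ∧ (∀ x : (N : ℕ) → (Fin N → EuclideanSpace ℝ (Fin 3)), (∀ N, Literature.MathematicalPhysics.StatisticalMechanics.IsGroundState Literature.MathematicalPhysics.StatisticalMechanics.lennardJones (x N)) → ∀ᶠ N in Filter.atTop, ∃ (S : Finset (Fin N)) (c : ℝ), 1000 * ((N : ℝ) - S.card) ≤ N ∧ 1 ≤ c ∧ c ≤ 53 / 50 ∧ (∀ i ∈ S, ∀ j ∈ S, i ≠ j → 1 ≤ c * dist (x N i) (x N j)) ∧ (S.card : ℝ) * ((∑' y : ↥(Literature.MathematicalPhysics.StatisticalMechanics.hcpStacking 1 (Real.sqrt (2 / 3))), ‖(y : EuclideanSpace ℝ (Fin 3))‖⁻¹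 ^ 6) - 1 / 20) ≤ ∑ i ∈ S, ∑ j ∈ S, (c * dist (x N i) (x N j))⁻¹ ^ 6) ∧ ((∀ x : (N : ℕ) → (Fin N → EuclideanSpace ℝ (Fin 3)), (∀ N, Literature.MathematicalPhysics.StatisticalMechanics.IsGroundState Literature.MathematicalPhysics.StatisticalMechanics.lennardJones (x N)) → ∀ᶠ N in Filter.atTop, ∃ (S : Finset (Fin N)) (c : ℝ), 1000 * ((N : ℝ) - S.card) ≤ N ∧ 1 ≤ c ∧ c ≤ 53 / 50 ∧ (∀ i ∈ S, ∀ j ∈ S, i ≠ j → 1 ≤ c * dist (x N i) (x N j)) ∧ ∀ (M : ℕ) (y : Fin M → EuclideanSpace ℝ (Fin 3)), (∀ i j, i ≠ j → 1 ≤ dist (y i) (y j)) → (S.card : ℝ) * ((∑ i, ∑ j, (dist (y i) (y j))⁻¹ ^ 6) / M - 1 / 20) ≤ ∑ i ∈ S, ∑ j ∈ S, (c * dist (x N i) (x N j))⁻¹ ^ 6) → Literature.MathematicalPhysics.StatisticalMechanics.IsCrystallizing Literature.MathematicalPhysics.StatisticalMechanics.lennardJones 3) ∧ (∃ P : Literature.MathematicalPhysics.StatisticalMechanics.PeriodicConfiguration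 3, IsLeast (Set.range fun Q : Literature.MathematicalPhysics.StatisticalMechanics.PeriodicConfiguration 3 => Q.energyPerParticle Literature.MathematicalPhysics.StatisticalMechanics.lennardJones) (P.energyPerParticle Literature.MathematicalPhysics.StatisticalMechanics.lennardJones))

/-- item stmt-AtomisticToContinuum-5056 · crux · rank 2 · open · by planner
why it might fail: Unproved at every t (only fcc/bcc/sc/ico/A15 checked). Pointwise form is FALSE: DLP Z_max(R) > Z_Barlow(R) for N ≥ 13, R_min(13) = 1.0456, 13e^{-1.093t} > 12e^{-t} for t < 0.86; a non-Barlow packing rich in near-contacts in (1.046, √2) may win at t ≈ 1–5; t→∞ is Hales2012 only at leading order.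
sources: CohnKumar2006, CohnEtAl2019, HopkinsStillingerTorquato2011, BeterminPetrache2017, Hales2012, HalesEtAl2015
[crux] Θ-PACK (card (Θ-pack), finite averaged form, equivalent to the stationary form by
superadditivity): for every t > 0, every N and every x : Fin N → ℝ³ with pairwise distances ≥ 1, Σ_i
Σ_{j≠i} exp(−t·dist(x_i,x_j)²) ≤ N · gaussianEnergy t (hcpStacking 1 √(2/3)) (= N·θ_hcp(t), hcp at
nearest-neighbour distance 1, rooted at its point 0). [difficulty: open-problem] -/
@[route_item "route-AtomisticToContinuum-HcpThetaUniversality", crux]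
def HcpThetaMaxPackings : Prop :=
  ∀ t : ℝ, 0 < t → ∀ (N : ℕ) (x : Fin N → EuclideanSpace ℝ (Fin 3)), (∀ i j, i ≠ j → 1 ≤ dist (x i) (x j)) → ∑ i, ∑ j ∈ Finset.univ.erase i, Real.exp (-t * dist (x i) (x j) ^ 2) ≤ (N : ℝ) * Literature.Barriers.AtomisticToContinuum.gaussianEnergy t (Literature.MathematicalPhysics.StatisticalMechanics.hcpStacking 1 (Real.sqrt (2 / 3)))

/-- item stmt-AtomisticToContinuum-5057 · crux · rank 3 · open · by planner
why it might fail: 1/20 hypothesis is stacking-blind (fcc deficit 1e-3) and tolerates ~0.3% vacancies or 13-neighbour sites; order must come from exact LJ minimality + stacking selection (J₂ ≈ −7e-5, uncertified): no self-improvement lemma in print; aperiodic/polytypic Barlow ground states falsify IsCrystallizing.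
sources: BlancLewin2015, Hales2012, BoroczkySzabo2016, KusnerKusnerLagariasShlosman2018, PartayOrtnerCsanyi2017, FlatleyTheil2015
[crux] RIGIDITY ENDGAME (card N5 "stability form" + the perturbative endgame, positional half): if
for every sequence of Lennard-Jones ground states x^N, eventually in N, there are S ⊆ Fin N with
#(Fin N∖S) ≤ N/1000 and λ ∈ [1, 53/50] such that λ·x^N|S is a unit packing whose r⁻⁶ double sum is ≥
#S·(S₆(y)/M − 1/20) for EVERY finite unit packing y of M points (i.e. within 1/20 per particle of
the packing supremum), then IsCrystallizing lennardJones 3 (Blanc–Lewin (15)–(17)). [deps: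
HcpThetaMaxPackings] [difficulty: open-problem] -/
@[route_item "route-AtomisticToContinuum-HcpThetaUniversality", crux]
def NearMaxGroundStatesCrystallize : Prop :=
  (∀ x : (N : ℕ) → (Fin N → EuclideanSpace ℝ (Fin 3)), (∀ N, Literature.MathematicalPhysics.StatisticalMechanics.IsGroundState Literature.MathematicalPhysics.StatisticalMechanics.lennardJones (x N)) → ∀ᶠ N in Filter.atTop, ∃ (S : Finset (Fin N)) (c : ℝ), 1000 * ((N : ℝ) - S.card) ≤ N ∧ 1 ≤ c ∧ c ≤ 53 / 50 ∧ (∀ i ∈ S, ∀ j ∈ S, i ≠ j → 1 ≤ c * dist (x N i) (x N j)) ∧ ∀ (M : ℕ) (y : Fin M → EuclideanSpace ℝ (Fin 3)), (∀ i j, i ≠ j → 1 ≤ dist (y i) (y j)) → (S.card : ℝ) * ((∑ i, ∑ j, (dist (y i) (y j))⁻¹ ^ 6) / M - 1 / 20) ≤ ∑ i ∈ S, ∑ j ∈ S, (c * dist (x N i) (x N j))⁻¹ ^ 6) → Literature.MathematicalPhysics.StatisticalMechanics.IsCrystallizing Literature.MathematicalPhysics.StatisticalMechanics.lennardJones 3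

/-- item stmt-AtomisticToContinuum-5058 · crux · rank 4 · open · by planner
why it might fail: Budget 6η·L₆ ≤ 0.048 forces η ≤ 5.5e-4: eventually all but N/1000 particles need EVERY bond ≥ 0.9994·a* (a* = 0.9712); persistent icosahedral cores (LJ13 radial bonds ≈ 3% short), relaxed surface layers or strained grain boundaries at density > 1e-3 break it; print bounds only the minimal distance.
sources: BlancLewin2015, Xue1997, Blanc2004, Stillinger2001, Doye2000, arXiv:1009.3003
[crux] LJ TRANSFER (card N5 "no-compression" + virial, made quantitative): for every sequence of LJ
ground states, eventually in N there are S ⊆ Fin N, #(Fin N∖S) ≤ N/1000, and λ ∈ [1, 53/50] with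
λ·dist ≥ 1 on S and Σ_{i,j∈S} (λ·dist(x_i,x_j))⁻⁶ ≥ #S·(L₆(hcp) − 1/20), L₆(hcp) = Σ_{y∈hcp} |y|⁻⁶ =
14.4549 at nearest-neighbour distance 1. Expected proof: virial E = −S₆/24 (LjVirialInvSix) + trial
upper bound E(N) ≤ N·e(hcp) + C N^{2/3} (e(hcp) = −L₆²/(24 L₁₂), scale a* = (L₁₂/L₆)^{1/6} = 0.9712)
+ LennardJonesMinimalDistance_holds + a NO-COMPRESSION lemma (bonds shorter than (1−η)a*, η ≈ 5e-4,
at o(N) particles) + sum_inv_pow_six_le for the discarded particles. [difficulty: XL] -/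
@[route_item "route-AtomisticToContinuum-HcpThetaUniversality", crux]
def LjGroundStatesNearInvSixMax : Prop :=
  ∀ x : (N : ℕ) → (Fin N → EuclideanSpace ℝ (Fin 3)), (∀ N, Literature.MathematicalPhysics.StatisticalMechanics.IsGroundState Literature.MathematicalPhysics.StatisticalMechanics.lennardJones (x N)) → ∀ᶠ N in Filter.atTop, ∃ (S : Finset (Fin N)) (c : ℝ), 1000 * ((N : ℝ) - S.card) ≤ N ∧ 1 ≤ c ∧ c ≤ 53 / 50 ∧ (∀ i ∈ S, ∀ j ∈ S, i ≠ j → 1 ≤ c * dist (x N i) (x N j)) ∧ (S.card : ℝ) * ((∑' y : ↥(Literature.MathematicalPhysics.StatisticalMechanics.hcpStacking 1 (Real.sqrt (2 / 3))), ‖(y : EuclideanSpace ℝ (Fin 3))‖⁻¹ ^ 6) - 1 / 20) ≤ ∑ i ∈ S, ∑ j ∈ S, (c * dist (x N i) (x N j))⁻¹ ^ 6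

/-- item stmt-AtomisticToContinuum-0627 · crux · rank 5 · open · by planner
why it might fail: False iff no periodic configuration attains inf e_LJ: optimal stackings of growing period tending to an aperiodic Barlow word (route RefuteCrystalPeriodicMin), i.e. Hägg domination |J₂| > Σ_{k≥3} k|J_k| failing at the 1e-4 scale; print has existence among Bravais lattices only.
sources: BlancLewin2015, BeterminSamajTravenec2022, PartayOrtnerCsanyi2017, Stillinger2001, doi:10.1103/physreve.107.065302
The infimum over periodic configurations of ℝ³ of the Lennard-Jones energy per particle is attained
(by some lattice G and finite motif F). Needs stacking selection (c) + compactness of near-optimal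
periodic configurations at bounded density / bounded-below distances; refuted if optimal LJ
stackings are aperiodic with unattained infimum (route RefuteCrystalPeriodicMin). -/
@[route_item "route-AtomisticToContinuum-HcpThetaUniversality", crux]
def CrysPeriodicMinAttained : Prop :=
  ∃ P : Literature.MathematicalPhysics.StatisticalMechanics.PeriodicConfiguration 3, IsLeast (Set.range fun Q : Literature.MathematicalPhysics.StatisticalMechanics.PeriodicConfiguration 3 => Q.energyPerParticle Literature.MathematicalPhysics.StatisticalMechanics.lennardJones) (P.energyPerParticle Literature.MathematicalPhysics.StatisticalMechanics.lennardJones)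

/-- item stmt-AtomisticToContinuum-0626 · support · rank 9 · closed · proved by Summit.AtomisticToContinuum.Crystallization.Theorems.crysEnergyLimit_proof @ f456c3bab3f9 (prover) · by planner
sources: BlancLewin2015
Energetic crystallization: E(N)/N converges to the infimum over periodic (multi-lattice)
configurations of the LJ energy per particle in d = 3. Lower bound liminf ≥ ⨅ is the content ((a)
local optimality + (d) + surface term O(N^{2/3})); upper bound is filed separately. -/
@[route_item "route-AtomisticToContinuum-HcpThetaUniversality", crux]
def CrysEnergyLimit : Prop :=
  Filter.Tendsto (fun N : ℕ => Literature.MathematicalPhysics.StatisticalMechanics.groundStateEnergy Literature.MathematicalPhysics.StatisticalMechanics.lennardJones 3 N / N) Filter.atTop (nhds (⨅ Q : Literature.MathematicalPhysics.StatisticalMechanics.PeriodicConfiguration 3, Q.energyPerParticle Literature.MathematicalPhysics.StatisticalMechanics.lennardJones))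

/-- `CrysEnergyLimit` holds: proved by `Summit.AtomisticToContinuum.Crystallization.Theorems.crysEnergyLimit_proof` @ f456c3bab3f9. -/
theorem CrysEnergyLimit_holds : CrysEnergyLimit := _root_.Summit.AtomisticToContinuum.Crystallization.Theorems.crysEnergyLimit_proof

/-- item stmt-AtomisticToContinuum-14147 · support · rank 9 · closed · proved by Summit.AtomisticToContinuum.Crystallization.Theorems.hcpThetaUniversality_targetGlue_proof @ 82479abee689 (prover) · by planner
sources: BlancLewin2015, CohnKumar2006
[support] GLUE (frame; provable now): the four cruxes assemble the thesis X = Target —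
HcpThetaMaxPackings (crux 2) → LjGroundStatesNearInvSixMax (crux 4) → NearMaxGroundStatesCrystallize
(crux 3) → CrysPeriodicMinAttained (crux 5, shared 0627) → Target. Target (rev 1) is verbatim the
conjunction of these four decl bodies in this order, so the proof is the anonymous constructor `fun
h₁ h₂ h₃ h₄ => ⟨h₁, h₂, h₃, h₄⟩` (kernel-checked in the planner's sketch). Filed to clear the hold
route.target-unreachable: it is the item that concludes Target, so Target closes by bookkeeping once
the four cruxes are proved; `closes` does not use it (it reaches Crystallization from the cruxes +
ThetaMaxImpliesSutherlandBound + CrysEnergyLimit directly). [difficulty: provable-now] -/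
@[route_item "route-AtomisticToContinuum-HcpThetaUniversality", crux]
def TargetGlue : Prop :=
  HcpThetaMaxPackings → LjGroundStatesNearInvSixMax → NearMaxGroundStatesCrystallize → CrysPeriodicMinAttained → Target

-- `TargetGlue` holds: proved by `Summit.AtomisticToContinuum.Crystallization.Theorems.hcpThetaUniversality_targetGlue_proof` @ 82479abee689 (its module imports this route file, so no `_holds` link can be stated here).

/-- item stmt-AtomisticToContinuum-3268 · support · rank 9 · open · by planner
sources: Stillinger2001, ConwaySloane1999, HopkinsStillingerTorquato2011
[support] SUTHERLAND RUNG, ENERGETIC ("hcp maximises the van der Waals attraction among all sphere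
packings"): for every N and every N-point unit packing x of ℝ³, Σ_i Σ_{j≠i} |x_i − x_j|⁻⁶ ≤ N ·
L₆(hcp) (diagonal terms are 0⁻¹ = 0 in Lean). Corollary of VdwOneCentre by summing over centres
(filed because it is the energetic top-rung statement other dispersion-tail cards want —
theta-universality-packings at its r⁻⁶ slice, adhesive-spheres-weak-cm-tail — and because it becomes
THE crux, to be proved by the two-shell deficit of VdwKissing plus an averaged tail transfer (card
D2), if the pointwise VdwOneCentre dies). With the hcp ball as trial packing it gives sup_N
(1/N)·max S₆ = L₆(hcp) and, via hcpPeriodicConfiguration, the periodic maximum is attained.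
[difficulty: M] -/
@[route_item "route-AtomisticToContinuum-HcpThetaUniversality", crux]
def SutherlandBound : Prop :=
  ∀ (N : ℕ) (x : Fin N → EuclideanSpace ℝ (Fin 3)), (∀ i j, i ≠ j → 1 ≤ dist (x i) (x j)) → ∑ i, ∑ j, (dist (x i) (x j))⁻¹ ^ 6 ≤ (N : ℝ) * ∑' y : ↥(Literature.MathematicalPhysics.StatisticalMechanics.hcpStacking 1 (Real.sqrt (2 / 3))), ‖(y : EuclideanSpace ℝ (Fin 3))‖⁻¹ ^ 6

/-- item stmt-AtomisticToContinuum-5059 · support · rank 9 · closed · proved by Summit.AtomisticToContinuum.Crystallization.Theorems.thetaMaxImpliesSutherlandBound_proof @ e01e93963620 (prover) · by planner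
sources: CohnKumar2006, CoulangeonSchurmann2011
[support] GLUE (Bernstein): r⁻⁶ = ½∫₀^∞ t² e^{−t r²} dt, finite sums commute with the integral and
Tonelli evaluates ∫ ½t²·θ_hcp(t) dt = L₆(hcp) (summable, non-negative terms); hence
HcpThetaMaxPackings → SutherlandBound. This is the step that makes crux 2 load-bearing in the
Assembly. [difficulty: provable-now] -/
@[route_item "route-AtomisticToContinuum-HcpThetaUniversality", crux]
def ThetaMaxImpliesSutherlandBound : Prop :=
  HcpThetaMaxPackings → SutherlandBound

-- `ThetaMaxImpliesSutherlandBound` holds: proved by `Summit.AtomisticToContinuum.Crystallization.Theorems.thetaMaxImpliesSutherlandBound_proof` @ e01e93963620 (its module imports this route file, so no `_holds` link can be stated here).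

/-- item stmt-AtomisticToContinuum-5060 · support · rank 9 · closed · proved by Summit.AtomisticToContinuum.Crystallization.Theorems.BarlowTheta.barlowThetaDominance_proof @ 9601316729d7 (prover) · by planner
sources: BeterminPetrache2017, ConwaySloane1999, HalesDSP2012
[support] BARLOW-INTERNAL THEOREM (card evidence (a); realises card monotone-pairing-stacking-lemma
for Gaussians): for every t > 0, every Hägg sequence s and every layer m, the Gaussian site energy
of barlowStacking 1 √(2/3) s at layer m is ≤ that of hcp (alternatingHagg) at layer 0. Proof sketch:
J_k(t) = e^{−t k² (2/3)}·(φ_A − φ_N)(t) with φ_A > φ_N by Poisson summation on the triangular layer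
(1 − cos ≥ 0), so J_k > 0 decreasing in k; the aligned set of any site has no two consecutive k and
misses k = 1, so Σ_{k aligned} J_k ≤ Σ_{k even} J_k (monotone pairing) — the hcp site. [difficulty:
M] -/
@[route_item "route-AtomisticToContinuum-HcpThetaUniversality", crux]
def BarlowThetaDominance : Prop :=
  ∀ t : ℝ, 0 < t → ∀ s : ℤ → ℤ, Literature.MathematicalPhysics.StatisticalMechanics.IsHaggSeq s → ∀ m : ℤ, Literature.MathematicalPhysics.StatisticalMechanics.barlowSiteEnergy (fun r => Real.exp (-t * r ^ 2)) 1 (Real.sqrt (2 / 3)) s m ≤ Literature.MathematicalPhysics.StatisticalMechanics.barlowSiteEnergy (fun r => Real.exp (-t * r ^ 2)) 1 (Real.sqrt (2 / 3)) Literature.MathematicalPhysics.StatisticalMechanics.alternatingHagg 0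

-- `BarlowThetaDominance` holds: proved by `Summit.AtomisticToContinuum.Crystallization.Theorems.BarlowTheta.barlowThetaDominance_proof` @ 9601316729d7 (its module imports this route file, so no `_holds` link can be stated here).

/-- item stmt-AtomisticToContinuum-5061 · support · rank 9 · closed · proved by Summit.AtomisticToContinuum.Crystallization.Theorems.ljVirialInvSix_proof @ acdfbfd15783 (prover) · by planner
sources: BlancLewin2015, Doye2000
[support] VIRIAL IDENTITY: a Lennard-Jones ground state x of N particles in ℝ³ is critical under
dilation x ↦ λx, so Σ r⁻¹² = Σ r⁻⁶ over pairs and interactionEnergy lennardJones x = −(1/24) Σ_i Σ_j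
dist(x_i,x_j)⁻⁶ (diagonal 0⁻¹ = 0); N ≤ 1 trivial. [difficulty: provable-now] -/
@[route_item "route-AtomisticToContinuum-HcpThetaUniversality", crux]
def LjVirialInvSix : Prop :=
  ∀ (N : ℕ) (x : Fin N → EuclideanSpace ℝ (Fin 3)), Literature.MathematicalPhysics.StatisticalMechanics.IsGroundState Literature.MathematicalPhysics.StatisticalMechanics.lennardJones x → Literature.MathematicalPhysics.StatisticalMechanics.interactionEnergy Literature.MathematicalPhysics.StatisticalMechanics.lennardJones x = -(1 / 24) * ∑ i, ∑ j, (dist (x i) (x j))⁻¹ ^ 6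

-- `LjVirialInvSix` holds: proved by `Summit.AtomisticToContinuum.Crystallization.Theorems.ljVirialInvSix_proof` @ acdfbfd15783 (its module imports this route file, so no `_holds` link can be stated here).

-- earlier Assembly (stmt-AtomisticToContinuum-5062, replaced 2026-08-15T16:34:39Z -> stmt-AtomisticToContinuum-10949): retired by None — HcpThetaMaxPackings → LjGroundStatesNearInvSixMax → NearMaxGroundStatesCrystallize → CrysPeriodicMinAttained → CrysEnergyLimit → Crystallization
/-- item stmt-AtomisticToContinuum-10949 · assembly · rank 1 · closed · proved by Summit.AtomisticToContinuum.Crystallization.Theorems.hcpThetaUniversality_assembly_proof @ e52526b61333 (prover) · by planner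
sources: BlancLewin2015, CohnKumar2006
[assembly] BOOKKEEPING, provable now by logic + one division (it is the body of the deciding theorem
`closes`, rev 4): HcpThetaMaxPackings → ThetaMaxImpliesSutherlandBound → LjGroundStatesNearInvSixMax
→ NearMaxGroundStatesCrystallize → CrysPeriodicMinAttained → CrysEnergyLimit → Crystallization.
Proof: the Bernstein item 5059 applied to crux 2 gives SutherlandBound, so S₆(y)/M ≤ L₆(hcp) for
every finite unit packing y of M points (div_le_of_le_mul₀; M = 0 by L₆ ≥ 0, tsum_nonneg), hence the
conclusion of crux 4 (benchmark L₆(hcp) − 1/20) implies the hypothesis of crux 3 (benchmark S₆(y)/M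
− 1/20, gcongr) → IsCrystallizing; crux 5 gives P with IsLeast, so ⨅_Q e(Q) = e(P)
(IsLeast.csInf_eq) and 0626 is the limit clause → HasPeriodicGroundStateEnergy. Restated 1:1 from
stmt-5062, which omitted the antecedent ThetaMaxImpliesSutherlandBound and so hid the real-analysis
(Bernstein/Tonelli) step of item 5059 inside a 'bookkeeping' item. [difficulty: provable-now] -/
@[route_item "route-AtomisticToContinuum-HcpThetaUniversality", crux]
def Assembly : Prop :=
  HcpThetaMaxPackings → ThetaMaxImpliesSutherlandBound → LjGroundStatesNearInvSixMax → NearMaxGroundStatesCrystallize → CrysPeriodicMinAttained → CrysEnergyLimit → Crystallization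

-- `Assembly` holds: proved by `Summit.AtomisticToContinuum.Crystallization.Theorems.hcpThetaUniversality_assembly_proof` @ e52526b61333 (its module imports this route file, so no `_holds` link can be stated here).

/-! D-0027 §2.1 — DECIDING THEOREM (planner-authored via `route open/edit --closes-file`; by planner-rchoice-AtomisticToContinuum-HcpThetaU-22b2a8fe-0 2026-08-16T03:04:45Z):
its hypotheses are this route's items and its conclusion the sub-problem Statement (glue_lint), and it elaborates with this file. -/

@[closes "route-AtomisticToContinuum-HcpThetaUniversality"] theorem closes : Target → HcpThetaMaxPackings → NearMaxGroundStatesCrystallize → LjGroundStatesNearInvSixMax →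
    CrysPeriodicMinAttained → CrysEnergyLimit → SutherlandBound → ThetaMaxImpliesSutherlandBound →
    BarlowThetaDominance → LjVirialInvSix → TargetGlue → Assembly → _root_.Crystallization := by
  intro _h_Target h_HcpThetaMaxPackings h_NearMaxGroundStatesCrystallize h_LjGroundStatesNearInvSixMax
    h_CrysPeriodicMinAttained h_CrysEnergyLimit _h_SutherlandBound h_ThetaMaxImpliesSutherlandBound
    _h_BarlowThetaDominance _h_LjVirialInvSix _h_TargetGlue _h_Assembly
  -- Direct bookkeeping (the same argument proves the `Assembly` item; `Assembly`, `Target` and the frame glue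
  -- `TargetGlue : cruxes → Target` are hypotheses it does not use).
  -- (1) Bernstein glue item: Θ-universality of hcp among packings (crux 2) ⇒ the r⁻⁶ packing bound SutherlandBound
  --     (derived from the rank-2 crux through the support item; the hypothesis `SutherlandBound` itself is not used)
  have hS : SutherlandBound := h_ThetaMaxImpliesSutherlandBound h_HcpThetaMaxPackings
  -- the hcp benchmark L₆ = Σ_{y ∈ hcp} ‖y‖⁻⁶ is non-negative (covers the empty competitor M = 0, where S₆(y)/M = 0/0 = 0)
  have hL : (0 : ℝ) ≤ ∑' y : ↥(Literature.MathematicalPhysics.StatisticalMechanics.hcpStacking 1 (Real.sqrt (2 / 3))),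
      ‖(y : EuclideanSpace ℝ (Fin 3))‖⁻¹ ^ 6 :=
    tsum_nonneg fun y => by positivity
  -- (2) positional half: LJ ground states are 1/20-near the hcp benchmark (crux 4); by SutherlandBound the hcp benchmark
  --     dominates S₆(y)/M for every finite unit packing y of M points, so they are 1/20-near the packing supremum, which is
  --     exactly the hypothesis of the rigidity endgame (crux 3)
  have hpos : Literature.MathematicalPhysics.StatisticalMechanics.IsCrystallizing
      Literature.MathematicalPhysics.StatisticalMechanics.lennardJones 3 := by
    apply h_NearMaxGroundStatesCrystallize
    intro x hx
    filter_upwards [h_LjGroundStatesNearInvSixMax x hx] with N hN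
    obtain ⟨S, c, hcard, hc1, hc2, hpack, hsum⟩ := hN
    refine ⟨S, c, hcard, hc1, hc2, hpack, ?_⟩
    intro M y hy
    have hy' := hS M y hy
    have hdiv : (∑ i, ∑ j, (dist (y i) (y j))⁻¹ ^ 6) / (M : ℝ) ≤
        ∑' z : ↥(Literature.MathematicalPhysics.StatisticalMechanics.hcpStacking 1 (Real.sqrt (2 / 3))),
          ‖(z : EuclideanSpace ℝ (Fin 3))‖⁻¹ ^ 6 :=
      div_le_of_le_mul₀ (Nat.cast_nonneg M) hL (by rw [mul_comm]; exact hy')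
    calc (S.card : ℝ) * ((∑ i, ∑ j, (dist (y i) (y j))⁻¹ ^ 6) / M - 1 / 20)
        ≤ (S.card : ℝ) * ((∑' z : ↥(Literature.MathematicalPhysics.StatisticalMechanics.hcpStacking 1 (Real.sqrt (2 / 3))),
            ‖(z : EuclideanSpace ℝ (Fin 3))‖⁻¹ ^ 6) - 1 / 20) := by
          gcongr
      _ ≤ ∑ i ∈ S, ∑ j ∈ S, (c * dist (x N i) (x N j))⁻¹ ^ 6 := hsum
  -- (3) energetic half: the periodic minimum is attained at some P (crux 5), so ⨅_Q e(Q) = e(P) (IsLeast.csInf_eq), and the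
  --     bookkeeping limit E(N)/N → ⨅_Q e(Q) (support 0626) is the limit clause of HasPeriodicGroundStateEnergy
  obtain ⟨P, hP⟩ := h_CrysPeriodicMinAttained
  have hinf : (⨅ Q : Literature.MathematicalPhysics.StatisticalMechanics.PeriodicConfiguration 3,
      Q.energyPerParticle Literature.MathematicalPhysics.StatisticalMechanics.lennardJones) =
      P.energyPerParticle Literature.MathematicalPhysics.StatisticalMechanics.lennardJones :=
    hP.csInf_eq
  have hlim : Filter.Tendsto
      (fun N : ℕ => Literature.MathematicalPhysics.StatisticalMechanics.groundStateEnergy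
        Literature.MathematicalPhysics.StatisticalMechanics.lennardJones 3 N / N) Filter.atTop
      (nhds (P.energyPerParticle Literature.MathematicalPhysics.StatisticalMechanics.lennardJones)) := by
    have h0 : CrysEnergyLimit := h_CrysEnergyLimit
    unfold CrysEnergyLimit at h0
    rw [hinf] at h0
    exact h0
  -- Crystallization = HasPeriodicGroundStateEnergy lennardJones 3 ∧ IsCrystallizing lennardJones 3
  exact ⟨⟨P, hP, hlim⟩, hpos⟩

end Summit.AtomisticToContinuum.Crystallization.Theses.HcpThetaUniversality
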